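import Summits.QuantumFields.YangMills.Theorems.AllWindowsColdBoxBoxHighLineSmearedFP
import Literature.MathematicalPhysics.QuantumFieldTheory.Balaban1983to89.B10Eq18SigmaSU2Haar

/-!
# TASK T-S5/U5.4b «orbit average in Pauli coordinates», BY NAME (planner ym-idea-2 g17's `Cruxes/BoxWindowHighSU2213/TaskS5Pauli.lean`,
# commit 2f88aa23cb46) — step (1b) of the comparison stubs S5 (LINE-19 ⟨stmt-QuantumFields-24004⟩/⟨24335⟩) and U5 (LINE-20 ⟨24336⟩)

Free-hands work of width seat `ym-line-sfw-p2-w3` (g39, cell `ym-idea-1`), assignment of planner ym-idea-2 g17 (2026-08-29T17:01:45Z).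
The task definitions `pauliGauge` and `OrbitAveragePauli` are copied VERBATIM from the task file (a `Cruxes/` file is not importable from
`Theorems/`); the theorem `orbitAveragePauli : OrbitAveragePauli` is the Bochner corollary of the Literature's finite-product exponential
chart for Haar measure on `SU(2)`:

  `orbitAverage H h U = ∫ A, h (U^{extendGauge H (expPauli ∘ A)}) d(Measure.pi fun _ => sigmaMeasure)`,

by ✓`measurePreserving_pi_expPauli ↥(interiorSites H)` (`Literature…B10Eq18SigmaSU2Haar`: the configuration chart
`A ↦ (expPauli (A x))_x` pushes `Π_x σ(|A_x|)d³A_x` to the product Haar probability `interiorGaugeMeasure H`) and Mathlib's `integral_map`,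
the integrand `g ↦ h (U^{extendGauge H g})` being measurable by ✓`measurable_gaugeTransformZd_extendGauge` (T-S5.1 file).  No smallness,
no integrability hypothesis (both sides are Bochner integrals of the same push-forward).  Mathlib + tree only; no `sorry`.

HONEST LABEL: an S brick of step (1b) (the Laplace asymptotics T-S5.4 of the orbit average is built over 4a–4e); S5, U5, ⟨24004⟩ ⟨24335⟩
⟨24336⟩ remain OPEN; no crux, rung or summit is proved; the Yang–Mills mass gap is NOT proved by this file.
-/

set_option autoImplicit false

noncomputable section

open MeasureTheory Matrix
open Literature.MathematicalPhysics.QuantumFieldTheory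
open Literature.MathematicalPhysics.QuantumFieldTheory.Balaban1983to89.B10Eq18SigmaSU2Haar
open Literature.MathematicalPhysics.QuantumLattice

namespace Summit.QuantumFields.YangMills.Theorems.AllWindowsColdBoxBoxHighLine

/-! ## The task texts (verbatim from `Cruxes/BoxWindowHighSU2213/TaskS5Pauli.lean`) -/

/-- Interior gauge transformation assembled from Pauli coordinates `A : interiorSites → ℝ³` (identity off the interior). -/
def pauliGauge (H : ℕ) (A : ↥(interiorSites H) → EuclideanSpace ℝ (Fin 3)) :
    Literature.Probability.LatticeModels.Site 4 → SU2 :=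
  extendGauge H fun x => expPauli (A x)

/-- T-S5.4b **(orbit average in Pauli coordinates; S)**: for measurable `h`, the orbit average over interior gauge transformations is
the integral over the gauge algebra at the interior sites against the product of the Literature's `sigmaMeasure`
(Haar of `SU(2)` pulled back to the exponential chart). -/
def OrbitAveragePauli : Prop :=
  ∀ (H : ℕ) (h : LGConfig 4 SU2 → ℝ), Measurable h → ∀ U : LGConfig 4 SU2,
    orbitAverage H h U =
      ∫ A : ↥(interiorSites H) → EuclideanSpace ℝ (Fin 3), h (gaugeTransformZd (pauliGauge H A) U)
        ∂(Measure.pi fun _ : ↥(interiorSites H) => sigmaMeasure)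

/-! ## The proof -/

/-- `pauliGauge` is the interior extension of the pointwise exponential chart (definitional). -/
theorem pauliGauge_eq (H : ℕ) (A : ↥(interiorSites H) → EuclideanSpace ℝ (Fin 3)) :
    pauliGauge H A = extendGauge H (fun x => expPauli (A x)) := rfl

/-- The orbit integrand `g ↦ h (U^{extendGauge H g})` is measurable for measurable `h`. -/
theorem measurable_orbitIntegrand (H : ℕ) {h : LGConfig 4 SU2 → ℝ} (hm : Measurable h) (U : LGConfig 4 SU2) :
    Measurable fun g : InteriorGauge H => h (gaugeTransformZd (extendGauge H g) U) := by
  have hι : Measurable (Prod.mk U : InteriorGauge H → LGConfig 4 SU2 × InteriorGauge H) := measurable_prodMk_left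
  have hT := (measurable_gaugeTransformZd_extendGauge H).comp hι
  exact hm.comp hT

/-- ★ **T-S5.4b «ORBIT AVERAGE IN PAULI COORDINATES», BY NAME.** [cite: Balaban1985UV3, (13) p. 259, (18) p. 260] -/
theorem orbitAveragePauli : OrbitAveragePauli := by
  intro H h hm U
  have hmp := measurePreserving_pi_expPauli (↥(interiorSites H))
  have hG := measurable_orbitIntegrand H hm U
  unfold orbitAverage interiorGaugeMeasure
  calc ∫ g, h (gaugeTransformZd (extendGauge H g) U) ∂(Measure.pi fun _ : ↥(interiorSites H) => haarProbability SU2)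
      = ∫ g, h (gaugeTransformZd (extendGauge H g) U)
          ∂(Measure.map (fun (A : ↥(interiorSites H) → EuclideanSpace ℝ (Fin 3)) (b : ↥(interiorSites H)) => expPauli (A b))
            (Measure.pi fun _ : ↥(interiorSites H) => sigmaMeasure)) := by rw [hmp.map_eq]
    _ = ∫ A : ↥(interiorSites H) → EuclideanSpace ℝ (Fin 3), h (gaugeTransformZd (extendGauge H (fun b => expPauli (A b))) U)
          ∂(Measure.pi fun _ : ↥(interiorSites H) => sigmaMeasure) :=
        integral_map hmp.measurable.aemeasurable hG.aestronglyMeasurable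
    _ = ∫ A : ↥(interiorSites H) → EuclideanSpace ℝ (Fin 3), h (gaugeTransformZd (pauliGauge H A) U)
          ∂(Measure.pi fun _ : ↥(interiorSites H) => sigmaMeasure) := rfl

end Summit.QuantumFields.YangMills.Theorems.AllWindowsColdBoxBoxHighLine

end
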